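/-
Copyright (c) 2026 the pub-hodgecm-mathlib formalisation cell (harness21).  Prover seat hodgecm-mathlib-K2E1-p10 (g0), Track B ∕ K2-LIT, h413 = `stmt-HodgeConjecture-24833`,
line `K2_E1_TraceFormulaBeta`, campaign «EIS-WHITTAKER-3», DEAL D-W4 «W2₃-fin-split» of the dealer K2E1-plan (g5) (DEALS MEMO fe56b7cd5d935977), FILE D: THE SUPPORT of the
ψ-twisted big-cell (Whittaker) integral of `GL₃(F)` in the frequencies — it VANISHES unless `ξ₁ ∈ 𝔭^{m₁}` and `ξ₂ ∈ 𝔭^{m₂}` (for EVERY complex `s`).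
-/
import Summits.HodgeConjecture.HodgeConjecture.Theorems.K2E1FiniteWhittakerSplitU3   -- ★ FILES A–C (this seat): currency, the twisted big-cell integral, unit value, window
import HarnessLib

/-!
# K2·E1 — `K2E1FiniteWhittakerSplitU3Support` (D-W4 FILE D): the split Whittaker factor is supported on the lattice `ξ₁ ∈ 𝔭^{m₁}`, `ξ₂ ∈ 𝔭^{m₂}`

Track B ∕ K2-LIT, crux h413 = `stmt-HodgeConjecture-24833`, route of record `HCCMUnconditional`; cell `hodgecm-mathlib`, squad K2, ENGINE E1, campaign «EIS-WHITTAKER-3», D-W4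
(CONVENTIONS W0₃ 2fdd2f7063acaab9 §6: the Whittaker frequency lattice `𝔞_W = {ξ : ord_w ξ ≥ m_w ∀ w}` — here its two conditions at a split place `v = ww̄`).  THEOREMS ONLY (no `def`,
no `instance`, no notation, no named-fact hypothesis, no `sorry`).  Currency of FILE A `K2E1FiniteWhittakerSplitU3Inner` (★ `K2E1GindikinKarpelevichSplitGL3` big-cell coordinates,
complex exponent `s` per height factor, `ψᵢ : AddChar F Circle` of conductor exponents `mᵢ` (`ψᵢ.HasConductorExp mᵢ`), characters `((ψᵢ (t * ξᵢ) : Circle) : ℂ)`).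

THE MATHEMATICS [Casselman1980 §3; CasselmanShalika1980 §1; JacquetLanglands1970 §3 (Whittaker functions are supported on a lattice in the frequency)].  The section `Φ_s(w₀·)` is
RIGHT `N(𝒪)`-invariant (it is right `K`-invariant), i.e. in coordinates `n(x,y,z)·n(a,b,c) = n(x+a, y+b, z+c+xb)`:
* `x ↦ x + a` (`a ∈ 𝒪`): `max(1,‖x+a‖,‖z‖) = max(1,‖x‖,‖z‖)` and `max(1,‖y‖,‖z−(x+a)y‖) = max(1,‖y‖,‖z−xy‖)` (★ §1 ultrametrics) — so the `x`-fibre `Fib` is `𝒪`-PERIODIC and, by translation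
  invariance of `μ`, `W(ξ;s) = ψ₁(aξ₁)·W(ξ;s)`; if `ξ₁ ∉ 𝔭^{m₁}` some `a ∈ 𝒪` has `ψ₁(aξ₁) ≠ 1` (★ `exists_mem_primePowBall_addChar_mul_ne_one`), hence **`W(ξ;s) = 0`**;
* the shear `(y,z) ↦ (y+b, z+xb)` (`b ∈ 𝒪`): `max(1,‖x‖,‖z+xb‖) = max(1,‖x‖,‖z‖)`, `max(1,‖y+b‖,‖w‖) = max(1,‖y‖,‖w‖)` — so `Fib(x) = ψ₂(bξ₂)·Fib(x)` for every `x`, hence **`Fib ≡ 0` and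
  `W(ξ;s) = 0` if `ξ₂ ∉ 𝔭^{m₂}`**.
Everything holds for EVERY complex `s` (only pointwise identities of the integrands and `∫ f(t + a) dμ = ∫ f dμ` are used; no convergence).
* §1 ultrametric invariances; §2 `𝒪`-periodicity of the fibre in `x` and the vanishing for `ξ₁ ∉ 𝔭^{m₁}`; §3 the shear, `Fib(x) = 0` and the vanishing for `ξ₂ ∉ 𝔭^{m₂}`;
  §4 corollaries at conductor `𝒪` (`‖ξᵢ‖ > 1 ⟹ W = 0`): with FILE C's unit value, the unramified split factor is `𝟙[‖ξ_w‖ ≤ 1]𝟙[‖ξ_w̄‖ ≤ 1]`-supported, `= (1−q^{−s})²(1−q^{−(2s−1)})` at units.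
SAT-WITNESS: nothing is quantified over a structure (`F` any non-archimedean local field, `μ` any additive Haar measure, `ψᵢ` any additive characters with a conductor exponent).
HONEST LABEL: HC_CM is proved only modulo the 7 printed citations (2 remaining named inputs: hLiu418 = `stmt-HodgeConjecture-24832`, h413 = `stmt-HodgeConjecture-24833`)
until rung 0 closes; this file asserts no named fact and closes no socket (lane `--supports stmt-HodgeConjecture-24833`, count-neutral).
References: [Casselman1980] §3 · [CasselmanShalika1980] §1 · [JacquetLanglands1970] §3 · [Tate1950] §2.2.
-/

set_option autoImplicit false
-- the mandated namespace repeats the single-problem summit's segment (`HodgeConjecture.HodgeConjecture`)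
set_option linter.dupNamespace false

noncomputable section

open MeasureTheory Filter Topology Set TopologicalSpace
open scoped NNReal ENNReal
open Literature.NumberTheory.GaloisRepresentations Literature.NumberTheory.GaloisRepresentations.IsNonarchimedeanLocalField
open Literature.NumberTheory.Automorphic Literature.NumberTheory.Automorphic.LocalFieldHaar
open Summit.HodgeConjecture.HodgeConjecture.Cruxes.HLiu418.K2LiuGKRankOneIntegral
open Summit.HodgeConjecture.HodgeConjecture.Cruxes.H413.K2E1GindikinKarpelevichSplitGL3
open Summit.HodgeConjecture.HodgeConjecture.Cruxes.H413.K2E1FiniteWhittakerSplitU3Inner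
open Summit.HodgeConjecture.HodgeConjecture.Cruxes.H413.K2E1FiniteWhittakerSplitU3Fibre

namespace Summit.HodgeConjecture.HodgeConjecture.Cruxes.H413.K2E1FiniteWhittakerSplitU3Support

variable {F : Type*} [Field F] [ValuativeRel F] [TopologicalSpace F] [IsNonarchimedeanLocalField F]

/-! ## §1  Ultrametric invariances under `N(𝒪)` -/

/-- `a ∈ 𝒪 ⟹ max(1,‖x+a‖) = max(1,‖x‖)` (in `ℝ`). [folklore] -/
theorem max_one_coe_normAbs_add_of_mem {a : F} (ha : a ∈ primePowBall F 0) (x : F) :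
    max 1 ((normAbs F (x + a) : ℝ≥0) : ℝ) = max 1 ((normAbs F x : ℝ≥0) : ℝ) := by
  have ha1 : normAbs F a ≤ 1 := by rw [mem_primePowBall_iff, zpow_zero] at ha; exact ha
  have ha1' : ((normAbs F a : ℝ≥0) : ℝ) ≤ 1 := by exact_mod_cast ha1
  apply le_antisymm
  · refine max_le (le_max_left _ _) ?_
    have h : ((normAbs F (x + a) : ℝ≥0) : ℝ) ≤ max ((normAbs F x : ℝ≥0) : ℝ) ((normAbs F a : ℝ≥0) : ℝ) := by exact_mod_cast normAbs_add_le_max x a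
    exact h.trans (max_le (le_max_right _ _) (ha1'.trans (le_max_left _ _)))
  · refine max_le (le_max_left _ _) ?_
    have h : ((normAbs F x : ℝ≥0) : ℝ) ≤ max ((normAbs F (x + a) : ℝ≥0) : ℝ) ((normAbs F (-a) : ℝ≥0) : ℝ) := by
      have := normAbs_add_le_max (x + a) (-a)
      rw [add_neg_cancel_right] at this
      exact_mod_cast this
    rw [normAbs_neg] at h
    exact h.trans (max_le (le_max_right _ _) (ha1'.trans (le_max_left _ _)))

/-- `a ∈ 𝒪 ⟹ max(1,‖x+a‖,‖z‖) = max(1,‖x‖,‖z‖)` (the first height factor is `N(𝒪)`-invariant in `x`). [folklore] -/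
theorem heightA_add_of_mem {a : F} (ha : a ∈ primePowBall F 0) (x z : F) :
    max 1 (max ((normAbs F (x + a) : ℝ≥0) : ℝ) ((normAbs F z : ℝ≥0) : ℝ)) = max 1 (max ((normAbs F x : ℝ≥0) : ℝ) ((normAbs F z : ℝ≥0) : ℝ)) := by
  rw [← max_assoc, max_one_coe_normAbs_add_of_mem ha, max_assoc]

/-- `a ∈ 𝒪 ⟹ max(1,‖y‖,‖w − a·y‖) = max(1,‖y‖,‖w‖)` (★ §1 `max_normAbs_sub_mul_of_le_one`, in `ℝ`). [folklore] -/
theorem heightB_sub_mul_of_mem {a : F} (ha : a ∈ primePowBall F 0) (y w : F) :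
    max 1 (max ((normAbs F y : ℝ≥0) : ℝ) ((normAbs F (w - a * y) : ℝ≥0) : ℝ)) = max 1 (max ((normAbs F y : ℝ≥0) : ℝ) ((normAbs F w : ℝ≥0) : ℝ)) := by
  have ha1 : normAbs F a ≤ 1 := by rw [mem_primePowBall_iff, zpow_zero] at ha; exact ha
  rw [← NNReal.coe_max, max_normAbs_sub_mul_of_le_one ha1 y w, NNReal.coe_max]

/-- `b ∈ 𝒪 ⟹ max(1,‖y+b‖,‖w‖) = max(1,‖y‖,‖w‖)` (the second height factor is invariant under `y ↦ y + b`). [folklore] -/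
theorem heightB_add_of_mem {b : F} (hb : b ∈ primePowBall F 0) (y w : F) :
    max 1 (max ((normAbs F (y + b) : ℝ≥0) : ℝ) ((normAbs F w : ℝ≥0) : ℝ)) = max 1 (max ((normAbs F y : ℝ≥0) : ℝ) ((normAbs F w : ℝ≥0) : ℝ)) := by
  rw [← max_assoc, max_one_coe_normAbs_add_of_mem hb, max_assoc]

section Haar

variable [MeasurableSpace F] [BorelSpace F] (μ : Measure F) [μ.IsAddHaarMeasure]

/-! ## §2  `𝒪`-periodicity of the fibre in `x`; vanishing for `ξ₁ ∉ 𝔭^{m₁}` -/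

omit [BorelSpace F] [μ.IsAddHaarMeasure] in
/-- **THE FIBRE IS `𝒪`-PERIODIC IN `x`** (every `ψ`, `ξ`, `s`): `a ∈ 𝒪 ⟹ Fib(x + a) = Fib(x)` — pointwise on the integrands (`z − (x+a)y = (z − xy) − a·y`, §1). [cite: Casselman1980, §3] -/
theorem integral_fibre_twisted_add_of_mem {a : F} (ha : a ∈ primePowBall F 0) (ψ : AddChar F Circle) (ξ : F) (s : ℂ) (x : F) :
    ∫ z, ((max 1 (max ((normAbs F (x + a) : ℝ≥0) : ℝ) ((normAbs F z : ℝ≥0) : ℝ)) : ℝ) : ℂ) ^ (-s) *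
        (∫ y, ((max 1 (max ((normAbs F y : ℝ≥0) : ℝ) ((normAbs F (z - (x + a) * y) : ℝ≥0) : ℝ)) : ℝ) : ℂ) ^ (-s) * ((ψ (y * ξ) : Circle) : ℂ) ∂μ) ∂μ =
      ∫ z, ((max 1 (max ((normAbs F x : ℝ≥0) : ℝ) ((normAbs F z : ℝ≥0) : ℝ)) : ℝ) : ℂ) ^ (-s) *
        (∫ y, ((max 1 (max ((normAbs F y : ℝ≥0) : ℝ) ((normAbs F (z - x * y) : ℝ≥0) : ℝ)) : ℝ) : ℂ) ^ (-s) * ((ψ (y * ξ) : Circle) : ℂ) ∂μ) ∂μ := by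
  refine integral_congr_ae (Eventually.of_forall fun z => ?_)
  simp only
  rw [heightA_add_of_mem ha]
  congr 2
  funext y
  rw [show z - (x + a) * y = (z - x * y) - a * y by ring, heightB_sub_mul_of_mem ha]

/-- **VANISHING OFF THE LATTICE IN `ξ₁`** (every `ψ₂`, `ξ₂`, `s`; `ψ₁` of conductor exponent `m₁`): if `ξ₁ ∉ 𝔭^{m₁}` then
`∫_x (∫_z max(1,‖x‖,‖z‖)^{−s} ∫_y max(1,‖y‖,‖z−xy‖)^{−s} ψ₂(yξ₂)) ψ₁(xξ₁) dμ = 0` — translate `x ↦ x + a` by an `a ∈ 𝒪` with `ψ₁(aξ₁) ≠ 1`: the integral equals `ψ₁(aξ₁)` times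
itself. [cite: Casselman1980, §3] [cite: JacquetLanglands1970, §3] -/
theorem integral_bigCell_whittaker_gl3_eq_zero_of_not_mem_left {ψ₁ : AddChar F Circle} {m₁ : ℤ} (hm₁ : ψ₁.HasConductorExp m₁) (ψ₂ : AddChar F Circle) {ξ₁ : F}
    (hξ₁ : ξ₁ ∉ primePowBall F m₁) (ξ₂ : F) (s : ℂ) :
    ∫ x, (∫ z, ((max 1 (max ((normAbs F x : ℝ≥0) : ℝ) ((normAbs F z : ℝ≥0) : ℝ)) : ℝ) : ℂ) ^ (-s) *
        (∫ y, ((max 1 (max ((normAbs F y : ℝ≥0) : ℝ) ((normAbs F (z - x * y) : ℝ≥0) : ℝ)) : ℝ) : ℂ) ^ (-s) * ((ψ₂ (y * ξ₂) : Circle) : ℂ) ∂μ) ∂μ) *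
        ((ψ₁ (x * ξ₁) : Circle) : ℂ) ∂μ = 0 := by
  obtain ⟨a, ha, hne⟩ := exists_mem_primePowBall_addChar_mul_ne_one hm₁ (n := 0) (by rwa [sub_zero])
  have hne' : ((ψ₁ (a * ξ₁) : Circle) : ℂ) ≠ 1 := fun h => hne (Circle.coe_eq_one.1 h)
  set W := ∫ x, (∫ z, ((max 1 (max ((normAbs F x : ℝ≥0) : ℝ) ((normAbs F z : ℝ≥0) : ℝ)) : ℝ) : ℂ) ^ (-s) *
        (∫ y, ((max 1 (max ((normAbs F y : ℝ≥0) : ℝ) ((normAbs F (z - x * y) : ℝ≥0) : ℝ)) : ℝ) : ℂ) ^ (-s) * ((ψ₂ (y * ξ₂) : Circle) : ℂ) ∂μ) ∂μ) *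
        ((ψ₁ (x * ξ₁) : Circle) : ℂ) ∂μ with hW
  -- translate `x ↦ x + a`
  have key : W = ((ψ₁ (a * ξ₁) : Circle) : ℂ) * W := by
    conv_lhs => rw [hW, ← integral_add_right_eq_self _ a]
    simp_rw [integral_fibre_twisted_add_of_mem μ ha ψ₂ ξ₂ s, add_mul, AddChar.map_add_eq_mul, Circle.coe_mul]
    rw [hW, ← integral_const_mul]
    refine integral_congr_ae (Eventually.of_forall fun x => ?_)
    simp only
    ring
  have h : (1 - ((ψ₁ (a * ξ₁) : Circle) : ℂ)) * W = 0 := by rw [sub_mul, one_mul, ← key, sub_self]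
  exact (mul_eq_zero.1 h).resolve_left (sub_ne_zero.2 (Ne.symm hne'))

/-! ## §3  The shear `(y,z) ↦ (y+b, z+xb)`; vanishing for `ξ₂ ∉ 𝔭^{m₂}` -/

/-- **THE SHEAR**: for `b ∈ 𝒪` and every `ψ, ξ, s, x`: `Fib(x) = ψ(bξ)·Fib(x)` — translate `y ↦ y + b` inside (`∫ f(y+b) dμ = ∫ f dμ`), then `z ↦ z + x·b` outside; the heights are
unchanged (§1: `max(1,‖y+b‖,·)`, and `max(1,‖x‖,‖z+xb‖)` via `z + xb = z − (−b)·x`). [cite: Casselman1980, §3] -/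
theorem integral_fibre_twisted_eq_mul_of_mem {b : F} (hb : b ∈ primePowBall F 0) (ψ : AddChar F Circle) (ξ : F) (s : ℂ) (x : F) :
    ∫ z, ((max 1 (max ((normAbs F x : ℝ≥0) : ℝ) ((normAbs F z : ℝ≥0) : ℝ)) : ℝ) : ℂ) ^ (-s) *
        (∫ y, ((max 1 (max ((normAbs F y : ℝ≥0) : ℝ) ((normAbs F (z - x * y) : ℝ≥0) : ℝ)) : ℝ) : ℂ) ^ (-s) * ((ψ (y * ξ) : Circle) : ℂ) ∂μ) ∂μ =
      ((ψ (b * ξ) : Circle) : ℂ) *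
        ∫ z, ((max 1 (max ((normAbs F x : ℝ≥0) : ℝ) ((normAbs F z : ℝ≥0) : ℝ)) : ℝ) : ℂ) ^ (-s) *
          (∫ y, ((max 1 (max ((normAbs F y : ℝ≥0) : ℝ) ((normAbs F (z - x * y) : ℝ≥0) : ℝ)) : ℝ) : ℂ) ^ (-s) * ((ψ (y * ξ) : Circle) : ℂ) ∂μ) ∂μ := by
  have hb' : -b ∈ primePowBall F 0 := neg_mem_primePowBall hb
  -- translate `z ↦ z + x b` in the outer integral (left-hand side only)
  conv_lhs => rw [← integral_add_right_eq_self _ (x * b)]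
  rw [← integral_const_mul]
  refine integral_congr_ae (Eventually.of_forall fun z => ?_)
  simp only
  -- translate `y ↦ y + b` in the inner integral
  have hI : ∫ y, ((max 1 (max ((normAbs F y : ℝ≥0) : ℝ) ((normAbs F (z + x * b - x * y) : ℝ≥0) : ℝ)) : ℝ) : ℂ) ^ (-s) * ((ψ (y * ξ) : Circle) : ℂ) ∂μ =
      ((ψ (b * ξ) : Circle) : ℂ) * ∫ y, ((max 1 (max ((normAbs F y : ℝ≥0) : ℝ) ((normAbs F (z - x * y) : ℝ≥0) : ℝ)) : ℝ) : ℂ) ^ (-s) * ((ψ (y * ξ) : Circle) : ℂ) ∂μ := by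
    rw [← integral_add_right_eq_self _ b, ← integral_const_mul]
    refine integral_congr_ae (Eventually.of_forall fun y => ?_)
    simp only
    rw [show z + x * b - x * (y + b) = z - x * y by ring, heightB_add_of_mem hb, add_mul, AddChar.map_add_eq_mul, Circle.coe_mul]
    ring
  rw [hI, show z + x * b = z - (-b) * x by ring, heightB_sub_mul_of_mem hb' x z, mul_left_comm]

/-- **THE FIBRE VANISHES OFF THE LATTICE IN `ξ₂`** (every `s`, `x`; `ψ` of conductor exponent `m`): `ξ ∉ 𝔭^{m} ⟹ Fib(x) = 0`. [cite: Casselman1980, §3] [cite: JacquetLanglands1970, §3] -/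
theorem integral_fibre_twisted_eq_zero_of_not_mem {ψ : AddChar F Circle} {m : ℤ} (hm : ψ.HasConductorExp m) {ξ : F} (hξ : ξ ∉ primePowBall F m) (s : ℂ) (x : F) :
    ∫ z, ((max 1 (max ((normAbs F x : ℝ≥0) : ℝ) ((normAbs F z : ℝ≥0) : ℝ)) : ℝ) : ℂ) ^ (-s) *
        (∫ y, ((max 1 (max ((normAbs F y : ℝ≥0) : ℝ) ((normAbs F (z - x * y) : ℝ≥0) : ℝ)) : ℝ) : ℂ) ^ (-s) * ((ψ (y * ξ) : Circle) : ℂ) ∂μ) ∂μ = 0 := by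
  obtain ⟨b, hb, hne⟩ := exists_mem_primePowBall_addChar_mul_ne_one hm (n := 0) (by rwa [sub_zero])
  have hne' : ((ψ (b * ξ) : Circle) : ℂ) ≠ 1 := fun h => hne (Circle.coe_eq_one.1 h)
  have key := integral_fibre_twisted_eq_mul_of_mem μ hb ψ ξ s x
  have h : (1 - ((ψ (b * ξ) : Circle) : ℂ)) * (∫ z, ((max 1 (max ((normAbs F x : ℝ≥0) : ℝ) ((normAbs F z : ℝ≥0) : ℝ)) : ℝ) : ℂ) ^ (-s) *
        (∫ y, ((max 1 (max ((normAbs F y : ℝ≥0) : ℝ) ((normAbs F (z - x * y) : ℝ≥0) : ℝ)) : ℝ) : ℂ) ^ (-s) * ((ψ (y * ξ) : Circle) : ℂ) ∂μ) ∂μ) = 0 := by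
    rw [sub_mul, one_mul, ← key, sub_self]
  exact (mul_eq_zero.1 h).resolve_left (sub_ne_zero.2 (Ne.symm hne'))

/-- **VANISHING OFF THE LATTICE IN `ξ₂`** (every `ψ₁`, `ξ₁`, `s`; `ψ₂` of conductor exponent `m₂`): if `ξ₂ ∉ 𝔭^{m₂}` then
`∫_x (∫_z max(1,‖x‖,‖z‖)^{−s} ∫_y max(1,‖y‖,‖z−xy‖)^{−s} ψ₂(yξ₂)) ψ₁(xξ₁) dμ = 0` (every fibre vanishes). [cite: Casselman1980, §3] [cite: JacquetLanglands1970, §3] -/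
theorem integral_bigCell_whittaker_gl3_eq_zero_of_not_mem_right (ψ₁ : AddChar F Circle) {ψ₂ : AddChar F Circle} {m₂ : ℤ} (hm₂ : ψ₂.HasConductorExp m₂) (ξ₁ : F) {ξ₂ : F}
    (hξ₂ : ξ₂ ∉ primePowBall F m₂) (s : ℂ) :
    ∫ x, (∫ z, ((max 1 (max ((normAbs F x : ℝ≥0) : ℝ) ((normAbs F z : ℝ≥0) : ℝ)) : ℝ) : ℂ) ^ (-s) *
        (∫ y, ((max 1 (max ((normAbs F y : ℝ≥0) : ℝ) ((normAbs F (z - x * y) : ℝ≥0) : ℝ)) : ℝ) : ℂ) ^ (-s) * ((ψ₂ (y * ξ₂) : Circle) : ℂ) ∂μ) ∂μ) *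
        ((ψ₁ (x * ξ₁) : Circle) : ℂ) ∂μ = 0 := by
  simp_rw [integral_fibre_twisted_eq_zero_of_not_mem μ hm₂ hξ₂ s, zero_mul]
  exact integral_zero F ℂ

/-! ## §4  Conductor `𝒪`: support on `‖ξᵢ‖ ≤ 1` -/

/-- **Conductor `𝒪`, `‖ξ₁‖ > 1 ⟹ W = 0`** (every `ψ₂ ξ₂ s`). [cite: CasselmanShalika1980, §1] [cite: Casselman1980, §3] -/
theorem integral_bigCell_whittaker_gl3_eq_zero_of_one_lt_normAbs_left {ψ₁ : AddChar F Circle} (h₁ : ψ₁.HasConductorExp 0) (ψ₂ : AddChar F Circle) {ξ₁ : F}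
    (hξ₁ : 1 < normAbs F ξ₁) (ξ₂ : F) (s : ℂ) :
    ∫ x, (∫ z, ((max 1 (max ((normAbs F x : ℝ≥0) : ℝ) ((normAbs F z : ℝ≥0) : ℝ)) : ℝ) : ℂ) ^ (-s) *
        (∫ y, ((max 1 (max ((normAbs F y : ℝ≥0) : ℝ) ((normAbs F (z - x * y) : ℝ≥0) : ℝ)) : ℝ) : ℂ) ^ (-s) * ((ψ₂ (y * ξ₂) : Circle) : ℂ) ∂μ) ∂μ) *
        ((ψ₁ (x * ξ₁) : Circle) : ℂ) ∂μ = 0 :=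
  integral_bigCell_whittaker_gl3_eq_zero_of_not_mem_left μ h₁ ψ₂ (fun h => not_le.2 hξ₁ (by rwa [mem_primePowBall_iff, zpow_zero] at h)) ξ₂ s

/-- **Conductor `𝒪`, `‖ξ₂‖ > 1 ⟹ W = 0`** (every `ψ₁ ξ₁ s`). [cite: CasselmanShalika1980, §1] [cite: Casselman1980, §3] -/
theorem integral_bigCell_whittaker_gl3_eq_zero_of_one_lt_normAbs_right (ψ₁ : AddChar F Circle) {ψ₂ : AddChar F Circle} (h₂ : ψ₂.HasConductorExp 0) (ξ₁ : F) {ξ₂ : F}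
    (hξ₂ : 1 < normAbs F ξ₂) (s : ℂ) :
    ∫ x, (∫ z, ((max 1 (max ((normAbs F x : ℝ≥0) : ℝ) ((normAbs F z : ℝ≥0) : ℝ)) : ℝ) : ℂ) ^ (-s) *
        (∫ y, ((max 1 (max ((normAbs F y : ℝ≥0) : ℝ) ((normAbs F (z - x * y) : ℝ≥0) : ℝ)) : ℝ) : ℂ) ^ (-s) * ((ψ₂ (y * ξ₂) : Circle) : ℂ) ∂μ) ∂μ) *
        ((ψ₁ (x * ξ₁) : Circle) : ℂ) ∂μ = 0 :=
  integral_bigCell_whittaker_gl3_eq_zero_of_not_mem_right μ ψ₁ h₂ ξ₁ (fun h => not_le.2 hξ₂ (by rwa [mem_primePowBall_iff, zpow_zero] at h)) s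

end Haar

end Summit.HodgeConjecture.HodgeConjecture.Cruxes.H413.K2E1FiniteWhittakerSplitU3Support

end
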